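import Literature.AnabelianGeometry.EtaleTheta.KummerFunctoriality
import Mathlib.Algebra.Colimit.Module
import Mathlib.GroupTheory.MonoidLocalization.GrothendieckGroup

/-!
# The Kummer map `κ : M → lim_{→ H} H¹(H, Λ(M))` and its functoriality (LANA §6.1), completed

Source: LANA Project interim report [LANA2026Report], §6.1 "Generalities on Kummer maps",
pp. 31–32. "Let `H` vary over an inductive system of (open) subgroups of `G` (with respect to
inclusion). … (c) one has `M = ⋃_H M^H` … Taking colimits in `H`, we obtain
`κ : M → lim_{→ H} H¹(H, Λ(M))`. This map is `G`-equivariant with respect to the natural action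
of `G` on `H¹`. We refer to all such maps as *Kummer maps*."

## What is here (proved)

* restriction along `H' ≤ H` as the `H¹`-map of the identity co-morphism (`CoMorphism.refl`), and
  its compatibility with Kummer classes (`resH1_kummerClass`, a special case of the functoriality
  square of `KummerFunctoriality.lean`);
* `H1Colimit A S` : the direct limit `lim_{→ i} H¹(S i, Λ(A))` over a directed family
  `S : ι → Subgroup G` of subgroups, antitone in `i` (Mathlib `AddCommGroup.DirectLimit`);
* `kummerMap` : `κ : A → lim_{→} H¹(S i, Λ(A))` for a rootable `A` (hypothesis (a)) under
  hypothesis (c) `A = ⋃_i A^{S i}`, well defined (`kummerMap_eq_of`: independent of the chosen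
  invariant subgroup — this uses directedness and the square), and a homomorphism
  (`kummerMapHom : Additive A →+ _`);
* the monoid case: for a commutative monoid `M` with `G`-action, `G` acts on `M^gp`
  (`grothendieckGroupAction`) and `κ_M := κ_{M^gp} ∘ (M → M^gp)` (`monoidKummerMap`), as in the
  source ("`M^H → (M^gp)^H → H¹(H, Λ(M))`", with `Λ(M) := lim M^gp[n]`).

Not here: the `G`-action on the colimit by conjugation and the resulting `G`-equivariance (the
cochain-level identity is `RootSystem.kummerCocycle_smul_conj` in `KummerClass.lean`), and the
passage of the functoriality square to the two colimits (level-wise: `CoMorphism.map_kummerClass`).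
Groups and modules live in `Type` (Mathlib's `groupCohomology` is single-universe).
-/

namespace Literature.AnabelianGeometry.EtaleTheta

open groupCohomology CategoryTheory

/-! ## The identity co-morphism and restriction maps -/

namespace CoMorphism

variable (G A : Type*) [Group G] [CommGroup A] [MulDistribMulAction G A]

/-- The identity co-morphism `(id, id) : (G, A) → (G, A)`; its `H¹`-maps are the restriction maps
`H¹(H, Λ(A)) → H¹(H', Λ(A))` for `H' ≤ H` (the transition maps of "`lim_{→ H}`",
[cite: LANA2026Report, §6.1 p.31]). -/
def refl : CoMorphism G A G A where
  groupHom := MonoidHom.id G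
  map := MonoidHom.id A
  map_smul _ _ := rfl

variable {G A}

/-- For the identity co-morphism the system condition `H'.map id ≤ H` is just `H' ≤ H`.
[cite: LANA2026Report, §6.1 p.32] -/
theorem refl_cond {H H' : Subgroup G} (h : H' ≤ H) : H'.map (refl G A).groupHom ≤ H := by
  change H'.map (MonoidHom.id G) ≤ H
  rwa [Subgroup.map_id]

end CoMorphism

section Colimit

variable {G : Type} [Group G] {A : Type} [CommGroup A] [MulDistribMulAction G A]

/-- Restriction `H¹(H, Λ(A)) → H¹(H', Λ(A))` for `H' ≤ H`, as a `ℤ`-linear map (transition map of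
the inductive system "`lim_{→ H} H¹(H, Λ(M))`", [cite: LANA2026Report, §6.1 p.31]). -/
noncomputable def resH1 {H H' : Subgroup G} (h : H' ≤ H) :
    H1 (cyclotomeRep (A := A) H) →ₗ[ℤ] H1 (cyclotomeRep (A := A) H') :=
  ((CoMorphism.refl G A).H1Map (CoMorphism.refl_cond h)).hom

/-- Restriction of invariants `A^H → A^{H'}` for `H' ≤ H` is the inclusion.
[cite: LANA2026Report, §6.1 p.31] -/
theorem coe_mapInvariants_refl {H H' : Subgroup G} (h : H' ≤ H) (a : invariants (A := A) H) :
    (((CoMorphism.refl G A).mapInvariants (CoMorphism.refl_cond h) a : invariants (A := A) H') : A)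
      = a := rfl

variable {ι : Type} [Preorder ι] [DecidableEq ι] (S : ι → Subgroup G)
  (hS : ∀ ⦃i j : ι⦄, i ≤ j → S j ≤ S i)

/-- The inductive system `i ↦ H¹(S i, Λ(A))` with restriction maps, over a family of subgroups
`S` antitone in `i` ("`H` var[ies] over an inductive system of (open) subgroups of `G` (with respect
to inclusion)", [cite: LANA2026Report, §6.1 p.31]). -/
noncomputable def H1System (i j : ι) (h : i ≤ j) :
    H1 (cyclotomeRep (A := A) (S i)) →+ H1 (cyclotomeRep (A := A) (S j)) :=
  (resH1 (hS h)).toAddMonoidHom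

variable (A) in
/-- `lim_{→ i} H¹(S i, Λ(A))`, the direct limit of the inductive system (Mathlib
`AddCommGroup.DirectLimit`). [cite: LANA2026Report, §6.1 p.31] -/
noncomputable abbrev H1Colimit : Type :=
  AddCommGroup.DirectLimit (fun i => H1 (cyclotomeRep (A := A) (S i))) (H1System (A := A) S hS)

/-- The structure map `H¹(S i, Λ(A)) → lim_{→} H¹(S ·, Λ(A))`. [cite: LANA2026Report, §6.1 p.31] -/
noncomputable abbrev toColimit (i : ι) : H1 (cyclotomeRep (A := A) (S i)) →+ H1Colimit A S hS :=
  AddCommGroup.DirectLimit.of (fun i => H1 (cyclotomeRep (A := A) (S i))) (H1System (A := A) S hS) i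

variable (A) in
/-- Hypothesis (c) of [cite: LANA2026Report, §6.1 p.31]: "one has `M = ⋃_H M^H`, where `H` varies
over the subgroups under consideration". -/
def IsExhausted : Prop := ∀ a : A, ∃ i : ι, a ∈ invariants (A := A) (S i)

variable [RootableBy A ℕ]

/-- Restriction sends the Kummer class of `a ∈ A^H` to the Kummer class of `a ∈ A^{H'}` (special
case of the functoriality square; [cite: LANA2026Report, §6.1 p.32]). -/
theorem resH1_kummerClass {H H' : Subgroup G} (h : H' ≤ H) (a : A) (ha : a ∈ invariants (A := A) H)
    (ha' : a ∈ invariants (A := A) H') :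
    resH1 h (kummerClass H ⟨a, ha⟩) = kummerClass H' ⟨a, ha'⟩ := by
  have key := (CoMorphism.refl G A).map_kummerClass (CoMorphism.refl_cond h) ⟨a, ha⟩
  have heq : (CoMorphism.refl G A).mapInvariants (CoMorphism.refl_cond h) ⟨a, ha⟩ = ⟨a, ha'⟩ :=
    Subtype.ext rfl
  rw [heq] at key
  exact key

/-- In the colimit, the Kummer class of `a` computed at level `i` agrees with the one computed at
any finer level `j ≥ i`. [cite: LANA2026Report, §6.1 p.31] -/
theorem toColimit_kummerClass_of_le {i j : ι} (h : i ≤ j) (a : A) (hi : a ∈ invariants (A := A) (S i))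
    (hj : a ∈ invariants (A := A) (S j)) :
    toColimit S hS i (kummerClass (S i) ⟨a, hi⟩) = toColimit S hS j (kummerClass (S j) ⟨a, hj⟩) :=
  calc toColimit S hS i (kummerClass (S i) ⟨a, hi⟩)
      = toColimit S hS j (H1System (A := A) S hS i j h (kummerClass (S i) ⟨a, hi⟩)) :=
        (AddCommGroup.DirectLimit.of_f (f := H1System (A := A) S hS) h _).symm
    _ = toColimit S hS j (kummerClass (S j) ⟨a, hj⟩) := by
        change toColimit S hS j (resH1 (hS h) (kummerClass (S i) ⟨a, hi⟩)) = _
        rw [resH1_kummerClass (hS h) a hi hj]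

variable [IsDirectedOrder ι]

/-- Well-definedness: the image in the colimit of the Kummer class of `a` does not depend on the
invariant subgroup of the system at which it is computed (directedness + the restriction square).
[cite: LANA2026Report, §6.1 p.31] -/
theorem toColimit_kummerClass_eq {i j : ι} (a : A) (hi : a ∈ invariants (A := A) (S i))
    (hj : a ∈ invariants (A := A) (S j)) :
    toColimit S hS i (kummerClass (S i) ⟨a, hi⟩) = toColimit S hS j (kummerClass (S j) ⟨a, hj⟩) := by
  obtain ⟨k, hik, hjk⟩ := exists_ge_ge i j
  have hk : a ∈ invariants (A := A) (S k) := fun γ => hi ⟨γ, hS hik γ.2⟩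
  rw [toColimit_kummerClass_of_le S hS hik a hi hk, toColimit_kummerClass_of_le S hS hjk a hj hk]

variable {S}

/-- **The Kummer map** `κ : A → lim_{→ H} H¹(H, Λ(A))` [cite: LANA2026Report, §6.1 p.31]:
`κ(a)` is the image of the level-`H` Kummer class of `a` for any `H` of the system fixing `a`
(hypothesis (c) supplies one; `kummerMap_eq_of` shows the choice is immaterial). -/
noncomputable def kummerMap (hc : IsExhausted A S) (a : A) : H1Colimit A S hS :=
  toColimit S hS (Classical.choose (hc a)) (kummerClass _ ⟨a, Classical.choose_spec (hc a)⟩)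

/-- `κ(a)` may be computed at any level fixing `a`. [cite: LANA2026Report, §6.1 p.31] -/
theorem kummerMap_eq_of (hc : IsExhausted A S) (a : A) (i : ι)
    (hi : a ∈ invariants (A := A) (S i)) :
    kummerMap hS hc a = toColimit S hS i (kummerClass (S i) ⟨a, hi⟩) :=
  toColimit_kummerClass_eq S hS a _ hi

/-- `κ(1) = 0`. [cite: LANA2026Report, §6.1 p.31] -/
theorem kummerMap_one (hc : IsExhausted A S) : kummerMap hS hc (1 : A) = 0 := by
  obtain ⟨i, hi⟩ := hc 1
  rw [kummerMap_eq_of hS hc 1 i hi]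
  have : (⟨1, hi⟩ : invariants (A := A) (S i)) = 1 := rfl
  rw [this, kummerClass_one, map_zero]

/-- `κ(ab) = κ(a) + κ(b)`. [cite: LANA2026Report, §6.1 p.31] -/
theorem kummerMap_mul (hc : IsExhausted A S) (a b : A) :
    kummerMap hS hc (a * b) = kummerMap hS hc a + kummerMap hS hc b := by
  obtain ⟨i, hi⟩ := hc a
  obtain ⟨j, hj⟩ := hc b
  obtain ⟨k, hik, hjk⟩ := exists_ge_ge i j
  have ha : a ∈ invariants (A := A) (S k) := fun γ => hi ⟨γ, hS hik γ.2⟩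
  have hb : b ∈ invariants (A := A) (S k) := fun γ => hj ⟨γ, hS hjk γ.2⟩
  have hab : a * b ∈ invariants (A := A) (S k) := (invariants (A := A) (S k)).mul_mem ha hb
  rw [kummerMap_eq_of hS hc _ k hab, kummerMap_eq_of hS hc _ k ha, kummerMap_eq_of hS hc _ k hb,
    ← map_add]
  congr 1
  exact kummerClass_mul (S k) ⟨a, ha⟩ ⟨b, hb⟩

/-- The Kummer map as a homomorphism `A → lim_{→ H} H¹(H, Λ(A))` (multiplicative to additive).
[cite: LANA2026Report, §6.1 p.31] -/
noncomputable def kummerMapHom (hc : IsExhausted A S) : Additive A →+ H1Colimit A S hS where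
  toFun a := kummerMap hS hc a.toMul
  map_zero' := kummerMap_one hS hc
  map_add' a b := kummerMap_mul hS hc a.toMul b.toMul

/-- The Kummer map is compatible with the level-`H` Kummer maps: `κ(a) = [κ_H(a)]` for `a ∈ A^H`.
[cite: LANA2026Report, §6.1 p.31] -/
theorem kummerMapHom_apply_of_mem (hc : IsExhausted A S) (i : ι) (a : invariants (A := A) (S i)) :
    kummerMapHom hS hc (Additive.ofMul (a : A)) = toColimit S hS i (kummerMapFixed (S i) (Additive.ofMul a)) :=
  kummerMap_eq_of hS hc a i a.2

end Colimit

/-! ## The monoid case: `M^H → (M^gp)^H → H¹(H, Λ(M))` -/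

section MonoidAction

variable {G : Type*} [Group G] {M : Type*} [CommMonoid M] [MulDistribMulAction G M]

/-- `M^gp → M^gp` induced by the action of `g` on `M`. [folklore] -/
private noncomputable def gpAct (g : G) : Algebra.GrothendieckGroup M →* Algebra.GrothendieckGroup M :=
  Algebra.GrothendieckGroup.lift
    (Algebra.GrothendieckGroup.of.comp (MulDistribMulAction.toMonoidHom M g))

/-- `gpAct g` on generators. [folklore] -/
private theorem gpAct_of (g : G) (m : M) :
    gpAct g (Algebra.GrothendieckGroup.of m) = Algebra.GrothendieckGroup.of (g • m) := by
  have h := Algebra.GrothendieckGroup.lift.symm_apply_apply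
    (Algebra.GrothendieckGroup.of.comp (MulDistribMulAction.toMonoidHom M g))
  rw [Algebra.GrothendieckGroup.lift_symm_apply] at h
  exact DFunLike.congr_fun h m

/-- Homomorphisms out of `M^gp` are determined on `M`. [folklore] -/
private theorem gp_hom_ext {N : Type*} [CommGroup N] {f₁ f₂ : Algebra.GrothendieckGroup M →* N}
    (h : ∀ m : M, f₁ (Algebra.GrothendieckGroup.of m) = f₂ (Algebra.GrothendieckGroup.of m)) :
    f₁ = f₂ := by
  apply Algebra.GrothendieckGroup.lift.symm.injective
  rw [Algebra.GrothendieckGroup.lift_symm_apply, Algebra.GrothendieckGroup.lift_symm_apply]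
  exact MonoidHom.ext h

variable (G M) in
/-- The `G`-action on the groupification `M^gp` induced by a `G`-action on the commutative monoid
`M` by monoid automorphisms — so that "`M^gp[n]`", "`(M^gp)^H`", `Λ(M) := lim M^gp[n]` of
[cite: LANA2026Report, §6.1 p.31] make sense: `g • (a/b) = (g • a)/(g • b)`. A `def` (made a local
instance below), not a global instance, to avoid competing with Mathlib's scalar actions on
localizations. -/
@[reducible] noncomputable def grothendieckGroupAction :
    MulDistribMulAction G (Algebra.GrothendieckGroup M) where
  smul g x := gpAct g x
  one_smul x := by
    change gpAct (1 : G) x = x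
    have : gpAct (M := M) (1 : G) = MonoidHom.id _ :=
      gp_hom_ext fun m => by rw [gpAct_of, one_smul, MonoidHom.id_apply]
    rw [this, MonoidHom.id_apply]
  mul_smul g h x := by
    change gpAct (g * h) x = gpAct g (gpAct h x)
    have : gpAct (M := M) (g * h) = (gpAct g).comp (gpAct h) := gp_hom_ext fun m => by
      rw [MonoidHom.comp_apply, gpAct_of, gpAct_of, gpAct_of, mul_smul]
    rw [this, MonoidHom.comp_apply]
  smul_mul g x y := map_mul (gpAct g) x y
  smul_one g := map_one (gpAct g)

attribute [local instance] grothendieckGroupAction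

/-- The action on generators: `g • [m] = [g • m]`. [cite: LANA2026Report, §6.1 p.31] -/
theorem smul_of (g : G) (m : M) :
    g • Algebra.GrothendieckGroup.of m = Algebra.GrothendieckGroup.of (g • m) :=
  gpAct_of g m

/-- Every element of `M^gp` is a quotient of two elements of `M`. [folklore] -/
private theorem exists_eq_of_div_of (x : Algebra.GrothendieckGroup M) :
    ∃ a b : M, x = Algebra.GrothendieckGroup.of a / Algebra.GrothendieckGroup.of b := by
  induction x using Localization.induction_on with
  | H y =>
    refine ⟨y.1, y.2, ?_⟩
    change Localization.mk y.1 y.2 = Localization.mk y.1 1 / Localization.mk (y.2 : M) 1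
    rw [Algebra.GrothendieckGroup.mk_div_mk, Localization.mk_eq_mk_iff, Localization.r_iff_exists]
    exact ⟨1, by simp [mul_comm]⟩

end MonoidAction

section MonoidKummer

variable {G : Type} [Group G] {M : Type} [CommMonoid M] [MulDistribMulAction G M]

attribute [local instance] grothendieckGroupAction

/-- An element of `M` fixed by a subgroup `H` gives an `H`-invariant element of `M^gp`
("`M^H → (M^gp)^H`", [cite: LANA2026Report, §6.1 p.31]). -/
theorem of_mem_invariants {H : Subgroup G} {m : M} (hm : ∀ γ : H, (γ : G) • m = m) :
    Algebra.GrothendieckGroup.of m ∈ invariants (A := Algebra.GrothendieckGroup M) H := by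
  intro γ
  change (γ : G) • Algebra.GrothendieckGroup.of m = Algebra.GrothendieckGroup.of m
  rw [smul_of, hm γ]

variable {ι : Type} [Preorder ι] [DecidableEq ι] [IsDirectedOrder ι] (S : ι → Subgroup G)
  (hS : ∀ ⦃i j : ι⦄, i ≤ j → S j ≤ S i)

variable (M) in
/-- Hypothesis (c) of [cite: LANA2026Report, §6.1 p.31] for the monoid: "`M = ⋃_H M^H`". -/
def IsExhaustedMonoid : Prop := ∀ m : M, ∃ i : ι, ∀ γ : S i, (γ : G) • m = m

include hS in
omit [DecidableEq ι] in
/-- If `M = ⋃ M^{S i}` (and the system is directed) then also `M^gp = ⋃ (M^gp)^{S i}`.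
[cite: LANA2026Report, §6.1 p.31] -/
theorem isExhausted_grothendieckGroup (hc : IsExhaustedMonoid M S) :
    IsExhausted (G := G) (Algebra.GrothendieckGroup M) S := by
  intro x
  obtain ⟨a, b, rfl⟩ := exists_eq_of_div_of x
  obtain ⟨i, hi⟩ := hc a
  obtain ⟨j, hj⟩ := hc b
  obtain ⟨k, hik, hjk⟩ := exists_ge_ge i j
  refine ⟨k, (invariants (A := Algebra.GrothendieckGroup M) (S k)).div_mem ?_ ?_⟩
  · exact of_mem_invariants fun γ => hi ⟨γ, hS hik γ.2⟩
  · exact of_mem_invariants fun γ => hj ⟨γ, hS hjk γ.2⟩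

variable [RootableBy (Algebra.GrothendieckGroup M) ℕ]

variable {S} in
/-- **The Kummer map of a monoid with `G`-action**, `κ : M → lim_{→ H} H¹(H, Λ(M))` with
`Λ(M) = lim_n M^gp[n]`, as the composite "`M^H → (M^gp)^H → H¹(H, Λ(M))`" followed by the colimit
[cite: LANA2026Report, §6.1 p.31] (hypotheses: (a) = rootability of `M^gp`, (c) = `hc`). -/
noncomputable def monoidKummerMap (hc : IsExhaustedMonoid M S) (m : M) :
    H1Colimit (Algebra.GrothendieckGroup M) S hS :=
  kummerMap hS (isExhausted_grothendieckGroup S hS hc) (Algebra.GrothendieckGroup.of m)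

variable {S} in
/-- `κ_M(m)` computed at any level `S i` fixing `m`. [cite: LANA2026Report, §6.1 p.31] -/
theorem monoidKummerMap_eq_of (hc : IsExhaustedMonoid M S) (m : M) (i : ι) (hi : ∀ γ : S i, (γ : G) • m = m) :
    monoidKummerMap hS hc m =
      toColimit S hS i (kummerClass (S i) ⟨Algebra.GrothendieckGroup.of m, of_mem_invariants hi⟩) :=
  kummerMap_eq_of hS _ _ i _

variable {S} in
/-- `κ_M` is a homomorphism: `κ(m m') = κ(m) + κ(m')`. [cite: LANA2026Report, §6.1 p.31] -/
theorem monoidKummerMap_mul (hc : IsExhaustedMonoid M S) (m m' : M) :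
    monoidKummerMap hS hc (m * m') = monoidKummerMap hS hc m + monoidKummerMap hS hc m' := by
  unfold monoidKummerMap
  rw [map_mul]
  exact kummerMap_mul hS _ _ _

end MonoidKummer

end Literature.AnabelianGeometry.EtaleTheta
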